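import Literature.Computability.AlgebraicComplexity.TableauEvalLabelMajor
import Literature.Computability.AlgebraicComplexity.TableauEvalLabelMajorSpec
import Literature.Computability.AlgebraicComplexity.PerDetHwvCertificateSemantics
import Mathlib.Data.List.Perm.Basic
import HarnessLib

/-!
# The label-major programme computes the specification, hence `evalC`

Lean checker of the GCT multiplicity-obstruction engine (cell `pub-gct`; honest framing: rung-1
multiplicity-obstruction search for permanent versus determinant at small `(n, m)`, no claim about
VP ≠ VNP or P ≠ NP). Correctness of the kernel programme `evalA` (`TableauEvalLabelMajor.lean`):

* §1 the pruned trie: `find` through `child`, and `find w (buildPTrie P V m []) = symEntry P w`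
  for words of length `m` with letters `< V`;
* §2 merging is invisible: `msortK` returns a permutation of its input, `compressA` preserves
  every weighted sum of values that is additive on equal states;
* §3 states versus residual columns: the residual columns `resid cols st u` of a state, activity
  = membership for column-strict columns, and the correspondence of one walk of the programme
  (`walkA`, over states, pruning along the trie) with one walk of the specification (`walkL`, over
  residual columns);
* §4 the layer invariant and **`evalA_eq_specL`**;
* §5 **`evalA_eq_evalC`**: for a list point all of whose terms have `m` forms and a column-strict
  network passing `Network.check`, `evalA P N = evalC P N` (via `specL_eq_evalC`, with the
  variables enumerated by `Fin N.varBound`).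

Elementary [folklore].
-/

noncomputable section

open scoped BigOperators

namespace Literature.Computability.AlgebraicComplexity

namespace TableauEval

open MvPolynomial

variable {R : Type*} [CommRing R]

/-! ## §1 The pruned trie -/

omit [CommRing R] in
/-- `isEmpty` characterises `empty`. [folklore] -/
theorem PTrie.isEmpty_iff (t : PTrie R) : t.isEmpty = true ↔ t = .empty := by
  cases t <;> simp [PTrie.isEmpty]

/-- Looking up a nonempty word goes through the child of its first letter. [folklore] -/
theorem PTrie.find_cons (t : PTrie R) (v : ℕ) (w : List ℕ) :
    t.find (v :: w) = (t.child v).find w := by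
  cases t with
  | empty => simp [PTrie.find, PTrie.child]
  | leaf a => cases w <;> simp [PTrie.find, PTrie.child]
  | node ts => simp [PTrie.find, PTrie.child]

/-- The empty trie evaluates to `0`. [folklore] -/
@[simp] theorem PTrie.find_empty (w : List ℕ) : (PTrie.empty : PTrie R).find w = 0 := by
  cases w <;> rfl

/-- Looking up the empty word: the leaf value, else `0`. [folklore] -/
theorem PTrie.find_nil (t : PTrie R) :
    t.find [] = match t with | .leaf a => a | _ => 0 := by
  cases t <;> rfl

/-- **The trie holds the symmetric-tensor entries**: for a word `w` of length `k` with letters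
`< V`, `find w (buildPTrie P V k pre) = symEntry P (pre ++ w)`. [folklore] -/
theorem find_buildPTrie [DecidableEq R] (P : Point R) (V : ℕ) : ∀ (k : ℕ) (pre w : List ℕ), w.length = k →
    (∀ v ∈ w, v < V) → (buildPTrie P V k pre).find w = symEntry P (pre ++ w)
  | 0, pre, w, hw, _ => by
    rw [List.length_eq_zero_iff] at hw; subst hw
    simp only [buildPTrie, PTrie.mkLeaf, List.append_nil]
    split_ifs with h
    · rw [PTrie.find_empty, h]
    · rfl
  | k + 1, pre, [], hw, _ => by simp at hw
  | k + 1, pre, v :: w, hw, hv => by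
    have hvV : v < V := hv v List.mem_cons_self
    have hw' : w.length = k := by simpa using hw
    have IH := find_buildPTrie P V k (pre ++ [v]) w hw' (fun x hx => hv x (List.mem_cons_of_mem _ hx))
    rw [List.append_assoc, List.singleton_append] at IH
    simp only [buildPTrie, PTrie.mkNode]
    split_ifs with h
    · -- every child is empty, in particular the `v`-th
      rw [PTrie.find_empty, ← IH]
      have hmem : buildPTrie P V k (pre ++ [v]) ∈ (List.range V).map fun i => buildPTrie P V k (pre ++ [i]) :=
        List.mem_map.mpr ⟨v, List.mem_range.mpr hvV, rfl⟩
      have he := (List.all_eq_true.mp h) _ hmem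
      rw [(PTrie.isEmpty_iff _).mp he, PTrie.find_empty]
    · rw [PTrie.find_cons, PTrie.child, List.getD_eq_getElem _ _ (by simpa using hvV)]
      simp only [List.getElem_map, List.getElem_range]
      exact IH

/-! ## §2 Sorting and compressing are invisible -/

/-- `splitF` returns a splitting of the list. [folklore] -/
theorem splitF_perm {α : Type*} : ∀ l : List α, ((splitF l).1 ++ (splitF l).2).Perm l
  | [] => List.Perm.refl _
  | a :: l => by
    have h : splitF (a :: l) = (a :: (splitF l).2, (splitF l).1) := rfl
    rw [h]
    exact (List.perm_append_comm.cons a).trans ((splitF_perm l).cons a)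

/-- The merge step returns a permutation. [folklore] -/
theorem mergeKAux_perm {β : Type*} (a : ℕ × β) (L₁ : List (ℕ × β))
    (rest : List (ℕ × β) → List (ℕ × β)) (hrest : ∀ l, (rest l).Perm (L₁ ++ l)) :
    ∀ l₂ : List (ℕ × β), (mergeKAux a rest l₂).Perm (a :: L₁ ++ l₂)
  | [] => by rw [mergeKAux]; exact (hrest []).cons a
  | b :: l₂ => by
    rw [mergeKAux]
    split_ifs
    · exact ((mergeKAux_perm a L₁ rest hrest l₂).cons b).trans
        (List.perm_middle.symm.trans (by simp))
    · exact (hrest _).cons a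

/-- `mergeK` returns a permutation of the concatenation. [folklore] -/
theorem mergeK_perm {β : Type*} : ∀ l₁ l₂ : List (ℕ × β), (mergeK l₁ l₂).Perm (l₁ ++ l₂)
  | [], l₂ => by rw [mergeK]; simp
  | a :: l₁, l₂ => by
    rw [mergeK]
    exact mergeKAux_perm a l₁ (mergeK l₁) (mergeK_perm l₁) l₂

/-- **Merge sort returns a permutation of its input** (for every fuel). [folklore] -/
theorem msortK_perm {β : Type*} : ∀ (d : ℕ) (l : List (ℕ × β)), (msortK d l).Perm l
  | 0, l => by rw [msortK]
  | d + 1, [] => by rw [msortK]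
  | d + 1, [a] => by rw [msortK]
  | d + 1, a :: b :: l => by
    rw [msortK]
    exact ((mergeK_perm _ _).trans ((msortK_perm d _).append (msortK_perm d _))).trans
      (splitF_perm _)

/-- **Compression preserves weightings**: for any `g` on states, `∑ v · g st` over `compressA l`
equals the same sum over `l`. [folklore] -/
theorem sum_compressA (g : List (List ℕ) → R) :
    ∀ l : List (ℕ × List (List ℕ) × R),
      ((compressA l).map fun e => e.2.2 * g e.2.1).sum = (l.map fun e => e.2.2 * g e.2.1).sum
  | [] => rfl
  | a :: l => by
    have IH := sum_compressA g l
    show ((pushA a (compressA l)).map fun e => e.2.2 * g e.2.1).sum = _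
    rw [List.map_cons, List.sum_cons, ← IH]
    cases hc : compressA l with
    | nil => simp [pushA]
    | cons b l' =>
      simp only [pushA]
      split_ifs with h
      · have h2 : a.2.1 = b.2.1 := by
          simp only [Bool.and_eq_true, decide_eq_true_eq] at h; exact h.2
        simp only [List.map_cons, List.sum_cons, add_mul, h2, add_assoc]
      · simp only [List.map_cons, List.sum_cons]

/-! ## §3 States versus residual columns -/

/-- The residual columns of a state at label `u`: the unused variables, and the labels `≥ u`.
[folklore] -/
def resid (cols : List Column) (st : List (List ℕ)) (u : ℕ) : List Column :=
  List.zipWith (fun c vs => (⟨vs, c.labels.filter fun l => decide (u ≤ l)⟩ : Column)) cols st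

omit [CommRing R] in
/-- At label `0` the residual columns of the initial state are the columns. [folklore] -/
theorem resid_zero : ∀ cols : List Column, resid cols (cols.map Column.vars) 0 = cols
  | [] => rfl
  | c :: cols => by
    rw [List.map_cons, resid, List.zipWith_cons_cons, ← resid, resid_zero cols]
    congr
    exact List.filter_eq_self.mpr fun l _ => by simp

omit [CommRing R] in
/-- For strictly increasing labels, "the least label `≥ u` is `u`" is "`u` is a label".
[folklore] -/
theorem active_filter_eq_elem (u : ℕ) : ∀ (labels : List ℕ), labels.Pairwise (· < ·) →
    (Column.active ⟨[], labels.filter fun l => decide (u ≤ l)⟩ u) = labels.elem u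
  | [], _ => by simp [Column.active]
  | a :: l, h => by
    have hl := active_filter_eq_elem u l h.of_cons
    simp only [Column.active, List.filter_cons] at hl ⊢
    by_cases hua : u ≤ a
    · rw [if_pos (by simpa using hua)]
      rcases Nat.lt_or_eq_of_le hua with hlt | rfl
      · -- `a > u`: not active, and `u ∉ a :: l`
        have h1 : (some a == some u) = false := by simp [Nat.ne_of_gt hlt]
        have h2 : (a :: l).elem u = false := by
          rw [List.elem_eq_mem, decide_eq_false_iff_not]
          intro hm
          rcases List.mem_cons.mp hm with rfl | hm
          · exact lt_irrefl _ hlt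
          · exact lt_asymm hlt (List.rel_of_pairwise_cons h hm)
        simp only [List.head?_cons, h1, h2]
      · simp
    · rw [if_neg (by simpa using hua), hl]
      have : u ≠ a := fun e => hua (e ▸ le_refl u)
      simp [this]

omit [CommRing R] in
/-- The variables of residual columns are the state. [folklore] -/
theorem map_vars_resid : ∀ (cols : List Column) (st : List (List ℕ)) (u : ℕ),
    st.length = cols.length → (resid cols st u).map Column.vars = st
  | [], [], _, _ => rfl
  | [], _ :: _, _, h => by simp at h
  | _ :: _, [], _, h => by simp at h
  | c :: cs, vs :: vss, u, h => by
    rw [resid, List.zipWith_cons_cons, List.map_cons, ← resid, map_vars_resid cs vss u (by simpa using h)]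

omit [CommRing R] in
/-- Filtering the labels `≥ u` then dropping `u` (present or not) leaves the labels `≥ u + 1`.
[folklore] -/
theorem filter_succ_of_active (u : ℕ) (labels : List ℕ) (h : labels.Pairwise (· < ·)) :
    (redB (Column.active ⟨[], labels.filter fun l => decide (u ≤ l)⟩ u)
        ⟨[], labels.filter fun l => decide (u ≤ l)⟩ 0).labels =
      labels.filter fun l => decide (u + 1 ≤ l) := by
  induction labels with
  | nil => simp [Column.active, redB]
  | cons a l ih =>
    have ih' := ih h.of_cons
    by_cases hua : u ≤ a
    · rcases Nat.lt_or_eq_of_le hua with hlt | rfl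
      · -- head `a > u`: inactive, both filters keep `a` and agree on the tail
        have hact : Column.active ⟨[], (a :: l).filter fun l => decide (u ≤ l)⟩ u = false := by
          simp [Column.active, hua, Nat.ne_of_gt hlt]
        rw [hact]
        simp only [redB, List.filter_cons]
        rw [if_pos (by simpa using hua), if_pos (by simpa using hlt)]
        congr 1
        -- on the tail no element equals `u`
        refine List.filter_congr fun x hx => ?_
        have hx' : u < x := lt_trans hlt (List.rel_of_pairwise_cons h hx)
        simp [le_of_lt hx', hx']
      · -- head `= u`: active, peeled
        have hact : Column.active ⟨[], (u :: l).filter fun l => decide (u ≤ l)⟩ u = true := by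
          simp [Column.active]
        rw [hact]
        have e1 : ((u :: l).filter fun l => decide (u ≤ l)) = u :: l.filter (fun l => decide (u ≤ l)) := by
          simp
        have e2 : ((u :: l).filter fun l => decide (u + 1 ≤ l)) = l.filter fun l => decide (u + 1 ≤ l) := by
          simp
        simp only [redB, Column.peel, e1, List.tail_cons, e2]
        refine List.filter_congr fun x hx => ?_
        have hx' : u < x := List.rel_of_pairwise_cons h hx
        simp [le_of_lt hx', hx']
    · have hlt : a < u := Nat.lt_of_not_le hua
      have e1 : ((a :: l).filter fun l => decide (u ≤ l)) = l.filter fun l => decide (u ≤ l) := by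
        simp [hua]
      have e2 : ((a :: l).filter fun l => decide (u + 1 ≤ l)) = l.filter fun l => decide (u + 1 ≤ l) := by
        simp [List.filter_cons]; omega
      rw [e1, e2, ih']

/-- **One walk of the programme is one walk of the specification.** For column-strict columns
`cols`, a state `st` of the same length and a trie `t`, summing any `f (parity, entry, state)`
with `f _ 0 _ = 0` over the outcomes of `walkA (plan cols u) st t` is summing
`f (parity, find word t, variables of the residual columns)` over the outcomes of
`walkL u (resid cols st u)`. [folklore] -/
theorem sum_walkA {M : Type*} [AddCommMonoid M] (u : ℕ) :
    ∀ (cols : List Column) (st : List (List ℕ)) (t : PTrie R) (f : Bool → R → List (List ℕ) → M),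
      (∀ c ∈ cols, c.labels.Pairwise (· < ·)) → st.length = cols.length → (∀ b s, f b 0 s = 0) →
      ((walkA (plan cols u) st t).map fun r => f r.1 r.2.1 r.2.2).sum =
        ((walkL u (resid cols st u)).map fun o => f o.1 (t.find o.2.1) (o.2.2.map Column.vars)).sum
  | [], [], t, f, _, _, hf => by
    cases t with
    | empty => simp [plan, walkA, resid, walkL, hf]
    | leaf a => simp [plan, walkA, resid, walkL, PTrie.find]
    | node ts => simp [plan, walkA, resid, walkL, PTrie.find, hf]
  | [], _ :: _, _, _, _, h, _ => by simp at h
  | _ :: _, [], _, _, _, h, _ => by simp at h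
  | c :: cs, vs :: vss, t, f, hcs, hlen, hf => by
    have hc : c.labels.Pairwise (· < ·) := hcs c List.mem_cons_self
    have hcs' : ∀ c' ∈ cs, c'.labels.Pairwise (· < ·) := fun c' h => hcs c' (List.mem_cons_of_mem _ h)
    have hlen' : vss.length = cs.length := by simpa using hlen
    have hact : (Column.active ⟨vs, c.labels.filter fun l => decide (u ≤ l)⟩ u) = c.labels.elem u := by
      rw [← active_filter_eq_elem u c.labels hc]; rfl
    rw [plan, List.map_cons, ← plan, resid, List.zipWith_cons_cons, ← resid, walkL, hact]
    cases hel : c.labels.elem u with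
    | false =>
      simp only [walkA, List.map_map, Bool.false_eq_true, ↓reduceIte]
      exact sum_walkA u cs vss t (fun b e s => f b e (vs :: s)) hcs' hlen' (fun b s => hf b _)
    | true =>
      simp only [walkA, ↓reduceIte, sum_map_flatMap, List.map_map]
      congr 1
      refine List.map_congr_left fun j _ => ?_
      simp only [Function.comp_def]
      split_ifs with he
      · -- pruned: every word through this child evaluates to `0`
        rw [List.map_nil, List.sum_nil, eq_comm]
        refine List.sum_eq_zero fun x hx => ?_
        rw [List.mem_map] at hx
        obtain ⟨o, _, rfl⟩ := hx
        rw [PTrie.find_cons, (PTrie.isEmpty_iff _).mp he, PTrie.find_empty, hf]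
      · rw [List.map_map]
        refine Eq.trans (sum_walkA u cs vss (t.child (vs.getD j 0))
          (fun b e s => f (xor (decide (j % 2 = 1)) b) e (vs.eraseIdx j :: s)) hcs' hlen'
          (fun b s => hf _ _)) ?_
        congr 1
        refine List.map_congr_left fun o _ => ?_
        rw [PTrie.find_cons]
        rfl

omit [CommRing R] in
/-- The outcomes of one walk of the programme are states of the same length. [folklore] -/
theorem length_of_mem_walkA : ∀ (pl : List Bool) (st : List (List ℕ)) (t : PTrie R)
    (r : Bool × R × List (List ℕ)), r ∈ walkA pl st t → pl.length = st.length →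
    r.2.2.length = st.length
  | [], [], t, r, hr, _ => by
    cases t <;> simp [walkA] at hr
    rcases hr with ⟨-, -, rfl⟩; rfl
  | [], _ :: _, _, _, _, h => by simp at h
  | _ :: _, [], _, _, _, h => by simp at h
  | b :: ps, vs :: vss, t, r, hr, hlen => by
    cases b with
    | false =>
      simp only [walkA, List.mem_map] at hr
      obtain ⟨r', hr', rfl⟩ := hr
      simp [length_of_mem_walkA ps vss t r' hr' (by simpa using hlen)]
    | true =>
      simp only [walkA, List.mem_flatMap] at hr
      obtain ⟨j, -, hj⟩ := hr
      split_ifs at hj with he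
      · simp at hj
      · rw [List.mem_map] at hj
        obtain ⟨r', hr', rfl⟩ := hj
        simp [length_of_mem_walkA ps vss _ r' hr' (by simpa using hlen)]

omit [CommRing R] in
/-- The residual columns of the outcomes of one walk of the specification, started on residual
columns at `u`, are residual columns at `u + 1`. [folklore] -/
theorem resid_of_mem_walkL (u : ℕ) : ∀ (cols : List Column) (st : List (List ℕ))
    (o : Bool × List ℕ × List Column), (∀ c ∈ cols, c.labels.Pairwise (· < ·)) →
    st.length = cols.length → o ∈ walkL u (resid cols st u) →
    o.2.2 = resid cols (o.2.2.map Column.vars) (u + 1)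
  | [], [], o, _, _, ho => by
    simp [resid, walkL] at ho; subst ho; rfl
  | [], _ :: _, _, _, h, _ => by simp at h
  | _ :: _, [], _, _, h, _ => by simp at h
  | c :: cs, vs :: vss, o, hcs, hlen, ho => by
    have hc : c.labels.Pairwise (· < ·) := hcs c List.mem_cons_self
    have hcs' : ∀ c' ∈ cs, c'.labels.Pairwise (· < ·) := fun c' h => hcs c' (List.mem_cons_of_mem _ h)
    have hlen' : vss.length = cs.length := by simpa using hlen
    have key := filter_succ_of_active u c.labels hc
    rw [resid, List.zipWith_cons_cons, ← resid, walkL] at ho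
    -- the activity of the head residual column does not depend on its variables
    have hact : (Column.active ⟨vs, c.labels.filter fun l => decide (u ≤ l)⟩ u) =
        Column.active ⟨[], c.labels.filter fun l => decide (u ≤ l)⟩ u := rfl
    rw [hact] at ho
    revert ho key
    cases Column.active ⟨[], c.labels.filter fun l => decide (u ≤ l)⟩ u <;> intro ho key
    · simp only [Bool.false_eq_true, ↓reduceIte, List.mem_map] at ho
      obtain ⟨o', ho', rfl⟩ := ho
      simp only [List.map_cons, resid, List.zipWith_cons_cons]
      rw [← resid, ← resid_of_mem_walkL u cs vss o' hcs' hlen' ho']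
      simp only [redB] at key
      rw [key]
    · simp only [↓reduceIte, List.mem_flatMap, List.mem_map] at ho
      obtain ⟨j, -, o', ho', rfl⟩ := ho
      simp only [List.map_cons, resid, List.zipWith_cons_cons]
      rw [← resid, ← resid_of_mem_walkL u cs vss o' hcs' hlen' ho']
      simp only [redB, Column.peel] at key
      simp only [Column.reduce, key]

/-! ## §4 The layer invariant -/

/-- The meaning of a layer at label `u`: values times the specification on the remaining labels
`[u, …, u + n - 1]` of the residual columns. [folklore] -/
def layerSpec (S : List ℕ → R) (cols : List Column) (u n : ℕ) (L : List (ℕ × List (List ℕ) × R)) : R :=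
  (L.map fun e => e.2.2 * specL S (List.range' u n) (resid cols e.2.1 u)).sum

/-- `layerSpec` is invariant under permutations of the layer. [folklore] -/
theorem layerSpec_perm (S : List ℕ → R) (cols : List Column) (u n : ℕ)
    {L L' : List (ℕ × List (List ℕ) × R)} (h : L.Perm L') : layerSpec S cols u n L = layerSpec S cols u n L' :=
  (h.map _).sum_eq

/-- **One layer step preserves the meaning.** [folklore] -/
theorem layerSpec_stepA (V : ℕ) (T : PTrie R) (cols : List Column)
    (hcs : ∀ c ∈ cols, c.labels.Pairwise (· < ·)) (u n : ℕ) (L : List (ℕ × List (List ℕ) × R))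
    (hL : ∀ e ∈ L, e.2.1.length = cols.length) :
    layerSpec (fun w => T.find w) cols (u + 1) n (stepA cols V T u L) =
      layerSpec (fun w => T.find w) cols u (n + 1) L := by
  unfold stepA
  unfold layerSpec
  refine Eq.trans (sum_compressA (fun st => specL (fun w => T.find w)
    (List.range' (u + 1) n) (resid cols st (u + 1))) _) ?_
  rw [((msortK_perm _ _).map _).sum_eq]
  unfold expandA
  rw [sum_map_flatMap]
  congr 1
  refine List.map_congr_left fun e he => ?_
  rw [List.map_map, List.range'_succ, specL]
  -- the walk of the programme against the walk of the specification
  have hw := sum_walkA (M := R) u cols e.2.1 T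
    (fun b a st' => smul3 b e.2.2 a * specL (fun w => T.find w) (List.range' (u + 1) n) (resid cols st' (u + 1)))
    hcs (hL e he) (fun b s => by simp [smul3])
  simp only [Function.comp_def]
  rw [hw, ← List.sum_map_mul_left]
  congr 1
  refine List.map_congr_left fun o ho => ?_
  rw [← resid_of_mem_walkL u cols e.2.1 o hcs (hL e he) ho]
  have key : ∀ (b : Bool) (v a X : R), smul3 b v a * X = v * (sgn b * a * X) := by
    intro b v a X; cases b <;> simp [smul3, sgn] <;> ring
  exact key _ _ _ _

/-- States in a layer keep the length of the column list. [folklore] -/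
theorem length_of_mem_stepA (V : ℕ) (T : PTrie R) (cols : List Column) (u : ℕ)
    (L : List (ℕ × List (List ℕ) × R)) (hL : ∀ e ∈ L, e.2.1.length = cols.length)
    (e : ℕ × List (List ℕ) × R) (he : e ∈ stepA cols V T u L) : e.2.1.length = cols.length := by
  unfold stepA at he
  -- compressA only produces states present in its input
  have hsub : ∀ (l : List (ℕ × List (List ℕ) × R)) x, x ∈ compressA l → ∃ y ∈ l, x.2.1 = y.2.1 := by
    intro l
    induction l with
    | nil => intro x hx; simp [compressA] at hx
    | cons a l ih =>
      intro x hx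
      change x ∈ pushA a (compressA l) at hx
      cases hc : compressA l with
      | nil => rw [hc, pushA] at hx; simp at hx; exact ⟨a, by simp, by rw [hx]⟩
      | cons b l' =>
        rw [hc, pushA] at hx
        split_ifs at hx with h
        · rcases List.mem_cons.mp hx with hx | hx
          · exact ⟨a, List.mem_cons_self, by rw [hx]⟩
          · obtain ⟨y, hy, e⟩ := ih x (by rw [hc]; exact List.mem_cons_of_mem _ hx)
            exact ⟨y, List.mem_cons_of_mem _ hy, e⟩
        · rcases List.mem_cons.mp hx with hx | hx
          · exact ⟨a, List.mem_cons_self, by rw [hx]⟩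
          · obtain ⟨y, hy, e⟩ := ih x (by rw [hc]; exact hx)
            exact ⟨y, List.mem_cons_of_mem _ hy, e⟩
  obtain ⟨y, hy, hxy⟩ := hsub _ e he
  rw [(msortK_perm _ _).mem_iff] at hy
  unfold expandA at hy
  rw [List.mem_flatMap] at hy
  obtain ⟨e0, he0, hy⟩ := hy
  rw [List.mem_map] at hy
  obtain ⟨r, hr, rfl⟩ := hy
  rw [hxy]
  simp only
  rw [length_of_mem_walkA _ _ _ r hr (by rw [plan, List.length_map, hL e0 he0]), hL e0 he0]

/-- **The layers compute the meaning.** [folklore] -/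
theorem layerSum_layersA (V : ℕ) (T : PTrie R) (cols : List Column)
    (hcs : ∀ c ∈ cols, c.labels.Pairwise (· < ·)) :
    ∀ (n u : ℕ) (L : List (ℕ × List (List ℕ) × R)), (∀ e ∈ L, e.2.1.length = cols.length) →
      layerSum (layersA cols V T (List.range' u n) L) = layerSpec (fun w => T.find w) cols u n L
  | 0, u, L, _ => by
    simp [layersA, layerSum, layerSpec, specL]
  | n + 1, u, L, hL => by
    rw [List.range'_succ, layersA, layerSum_layersA V T cols hcs n (u + 1) _
      (length_of_mem_stepA V T cols u L hL), layerSpec_stepA V T cols hcs u n L hL]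

/-- Labels of a column-strict network are pairwise increasing. [folklore] -/
theorem pairwise_of_columnStrict (N : Network) (h : N.columnStrict = true) :
    ∀ c ∈ N.cols, c.labels.Pairwise (· < ·) := fun c hc =>
  pairwise_of_strictAsc _ ((List.all_eq_true.mp h) c hc)

/-- **The programme computes the specification** (with the trie's entries as entry function).
[folklore] -/
theorem evalA_eq_specL [DecidableEq R] (P : Point R) (N : Network) (hcs : N.columnStrict = true) :
    evalA P N = specL (fun w => (buildPTrie P N.varBound N.perLabel []).find w)
      (List.range N.nlabels) N.cols := by
  unfold evalA
  rw [List.range_eq_range', layerSum_layersA N.varBound _ N.cols (pairwise_of_columnStrict N hcs)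
    N.nlabels 0 _ (fun e he => by simp [Network.initLayer] at he; subst he; simp)]
  simp [layerSpec, Network.initLayer, resid_zero]

/-! ## §5 The programme computes `evalC` -/

/-- The enumeration of `Fin V` by `0, …, V-1`. [folklore] -/
def finEnum (V : ℕ) (hV : 0 < V) : Enum (Fin V) V where
  x i := ⟨i % V, Nat.mod_lt _ hV⟩
  xinv v := v
  xinv_lt v := v.isLt
  x_xinv v := Fin.ext (Nat.mod_eq_of_lt v.isLt)
  xinv_x i hi := by simp [Nat.mod_eq_of_lt hi]

omit [CommRing R] in
/-- Alternator variables are below the variable bound. [folklore] -/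
theorem lt_varBound (N : Network) (c : Column) (hc : c ∈ N.cols) (v : ℕ) (hv : v ∈ c.vars) :
    v < N.varBound := by
  unfold Network.varBound
  have h1 : v ≤ c.vars.foldr max 0 := ArithCircuit.le_foldr_max_of_mem hv
  have h2 : c.vars.foldr max 0 ≤ (N.cols.map fun c => c.vars.foldr max 0).foldr max 0 :=
    ArithCircuit.le_foldr_max_of_mem (List.mem_map.mpr ⟨c, hc, rfl⟩)
  omega

/-- **The label-major programme computes the column-major evaluator**: for a list point all of
whose terms have `m` forms and a column-strict network passing its structural check,
`evalA P N = evalC P N`. [folklore] -/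
theorem evalA_eq_evalC [DecidableEq R] (P : Point R) (N : Network)
    (hP : ∀ t : Fin P.terms.length, (P.terms.get t).2.length = N.perLabel)
    (hN : N.check = true) (hcs : N.columnStrict = true) : evalA P N = evalC P N := by
  obtain ⟨hlen, hlab, hcnt⟩ := Network.spec_of_check N hN
  have hV : 0 < N.varBound := Nat.succ_pos _
  let E := finEnum N.varBound hV
  rw [evalA_eq_specL P N hcs]
  refine specL_eq_evalC E P N hP hlen (fun c hc v hv => lt_varBound N c hc v hv) hlab hcnt hcs _
    fun w hw hv => ?_
  rw [← symEntry_eq_S E P hP w hw hv, find_buildPTrie P N.varBound N.perLabel [] w hw hv,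
    List.nil_append]

end TableauEval

end Literature.Computability.AlgebraicComplexity

end
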